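import Mathlib
import HarnessLib
import Summits.HubbardSuperconductivity.HubbardSuperconductivity.Theorems.KLProgrammeKLRegimeEngineScaleZeroE4GridVertex

/-!
# K3 engine (stmt-HubbardSuperconductivity-19918 and its gen-6 successor), stub `stub_twoLeg_scale0`, input of `B₂`: the pinned profile of
# the grid vertex `V_N + 𝒩_{K,N}` against the SQUARED tree weight `(1 + diam)²`

Cell gate-hubbard-kl, seat p3 (g7); the `N_{w²}` hypothesis of `…EngineScaleZeroTwoLegGridSumsWeights.twoLeg_offDiag_moment_two_sum_le` (the
off-diagonal SECOND spatial moment of the scale-`0` two-leg kernel), discharged as the twin of k3c2-p1's `sum_norm_kernel_gridVertex_mul_wt_le`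
(weight `gridLabelWt = 1 + diam`) for the degree-`2` diameter weight `wt₂(S) = (1 + diam_d S)²`, `d = gridLabelDist L N β′`:

* `sqWt_image_eq_one_of_kernel_hubbardGridInteraction_ne_zero` — the quartic grid vertex is ultralocal: on its support `wt₂ = 1`
  (from `gridLabelWt_image_eq_one_of_kernel_hubbardGridInteraction_ne_zero`: the diameter of the position set vanishes);
* `sum_norm_kernel_hubbardGridInteraction_mul_sqWt_le` — `Σ_{X : X q = w} ‖kernel V_N 4 X‖·wt₂ ≤ |U||β|/N`;
* `sqWt_pair_sameTime` — the two legs of a time-local hopping monomial have `wt₂ = (1 + |x⃗ − y⃗|_{ℓ^∞})²`;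
* `sum_norm_kernel_hubbardGridCounterQuadratic_mul_sqWt_le` — `Σ_{Y : Y p = w} ‖kernel 𝒩_{K,N} 2 Y‖·wt₂ ≤ (|β|/N)·Σ_z ‖Ǩ_L(z)‖·(1 + |z|_{ℓ^∞})²`;
* **`sum_norm_kernel_gridVertex_mul_sqWt_le`** — the profile: `N_{w²}(1) = (|β|/N)·Σ_z ‖Ǩ_L(z)‖(1+|z|_{ℓ^∞})²`, `N_{w²}(2) = |U||β|/N`, `0` otherwise.

What then remains for `B₂`: the SECOND position moment `Σ_z ‖Ǩ_L(z)‖(1+|z|_{ℓ^∞})²` of the frame kernel under `FrameOK` (the twin of p3 g6's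
first-moment bound `sum_abs_mul_norm_framePosKernel_le_of_frameOK`, one symbol derivative higher) and the `(1+diam)²`-weighted covariance sizes.

Everything is PROVED; no definitions; nothing about the model is asserted.  References: BGM 2006 §3 (3.2)–(3.8) [cite: BenfattoGiulianiMastropietro2006];
Salmhofer 1999 §4.2.4 (4.58) [cite: Salmhofer1999].
-/

noncomputable section

namespace Summit.HubbardSuperconductivity.HubbardSuperconductivity.Theorems.EngineV8

set_option linter.dupNamespace false -- summit = problem name (single-conjunct summit), D-0017

open Real Finset Literature.MathematicalPhysics.QuantumLattice Literature.Probability.LatticeModels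
open Literature.Probability.LatticeModels.BattleFederbush GrassmannAlgebra
open Summit.HubbardSuperconductivity.HubbardSuperconductivity.Theorems.KLRegimeSplit

variable {L Ng : ℕ} [NeZero L] [NeZero Ng]

/-! ## §1 The quartic vertex: `wt₂ = 1` on its support -/

/-- **The squared weight of the position set of a quartic kernel entry is `1`** (all four legs at one grid point). -/
theorem sqWt_image_eq_one_of_kernel_hubbardGridInteraction_ne_zero (β U β' : ℝ) (X : Fin 4 → GridLeg (GridPoint L Ng))
    (hX : kernel ℂ (hubbardGridInteraction L Ng β U) 4 X ≠ 0) :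
    diamWeight (fun s => (1 + 1 * s) ^ 2) (gridLabelDist L Ng β') ((univ.image X).image gridLegPos) = 1 := by
  have h := gridLabelWt_image_eq_one_of_kernel_hubbardGridInteraction_ne_zero β β' U X hX
  rw [gridLabelWt_apply] at h
  have hd : labelDiam (gridLabelDist L Ng β') ((univ.image X).image gridLegPos) = 0 := by linarith
  rw [diamWeight, hd]
  norm_num

/-- **Squared-weight pinned sums of the quartic grid vertex**: `Σ_{X : X q = w} ‖kernel V_N 4 X‖·wt₂ ≤ |U|·|β|/N`. -/
theorem sum_norm_kernel_hubbardGridInteraction_mul_sqWt_le (β U β' : ℝ) (q : Fin 4) (w : GridLeg (GridPoint L Ng)) :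
    ∑ X ∈ univ.filter (fun X : Fin 4 → GridLeg (GridPoint L Ng) => X q = w),
        ‖kernel ℂ (hubbardGridInteraction L Ng β U) 4 X‖ *
          diamWeight (fun s => (1 + 1 * s) ^ 2) (gridLabelDist L Ng β') ((univ.image X).image gridLegPos) ≤ |U| * |β| / Ng := by
  refine le_trans (sum_le_sum fun X _ => ?_) (sum_norm_kernel_hubbardGridInteraction_le β U q w)
  by_cases hX : kernel ℂ (hubbardGridInteraction L Ng β U) 4 X = 0
  · rw [hX, norm_zero, zero_mul]
  · rw [sqWt_image_eq_one_of_kernel_hubbardGridInteraction_ne_zero β U β' X hX, mul_one]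

/-! ## §2 The counterterm: pair weight `(1 + |x⃗ − y⃗|)²` -/

/-- The squared pair weight of the two legs of a time-local hopping monomial `ψ⁺_{(j,x⃗)} ψ⁻_{(j,y⃗)}`: `(1 + |x⃗ − y⃗|_{ℓ^∞})²`. -/
theorem sqWt_pair_sameTime {β' : ℝ} (hβ' : 0 ≤ β') (j : Fin Ng) (x y : TorusSite 2 L) (σ σ' c c' : Fin 2) :
    diamWeight (fun s => (1 + 1 * s) ^ 2) (gridLabelDist L Ng β')
        {gridLegPos ((((j, x), σ), c) : GridLeg (GridPoint L Ng)), gridLegPos ((((j, y), σ'), c') : GridLeg (GridPoint L Ng))} =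
      (1 + torusSiteDist (x - y) 0) ^ 2 := by
  rw [diamWeight_pair (isLabelDist_gridLabelDist L Ng hβ'), gridLegPos_apply, gridLegPos_apply, gridLabelDist_apply,
    (isLabelDist_cyclicDist Ng).self, mul_zero, zero_add, one_mul, torusSiteDist_eq_sub_zero]

/-- **Squared-weight pinned sums of the grid counterterm**:
`Σ_{Y : Y p = w} ‖kernel 𝒩_{K,N} 2 Y‖·wt₂(pos Y) ≤ (|β|/N)·Σ_z ‖Ǩ_L(z)‖·(1 + |z|_{ℓ^∞})²`. -/
theorem sum_norm_kernel_hubbardGridCounterQuadratic_mul_sqWt_le (β : ℝ) {β' : ℝ} (hβ' : 0 ≤ β') (K : TrigPolyC4v) (p : Fin 2)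
    (w : GridLeg (GridPoint L Ng)) :
    ∑ Y ∈ univ.filter (fun Y : Fin 2 → GridLeg (GridPoint L Ng) => Y p = w),
        ‖kernel ℂ (hubbardGridCounterQuadratic L Ng β K) 2 Y‖ *
          diamWeight (fun s => (1 + 1 * s) ^ 2) (gridLabelDist L Ng β') ((univ.image Y).image gridLegPos) ≤
      |β| / Ng * ∑ z : TorusSite 2 L, ‖framePosKernel L K z‖ * (1 + torusSiteDist z 0) ^ 2 := by
  rw [hubbardGridCounterQuadratic_eq_sum]
  set ω : (Fin 2 → GridLeg (GridPoint L Ng)) → ℝ := fun Y =>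
    diamWeight (fun s => (1 + 1 * s) ^ 2) (gridLabelDist L Ng β') ((univ.image Y).image gridLegPos) with hω
  set φ : Fin 2 × (GridPoint L Ng × TorusSite 2 L) → ℝ := fun i => (1 + torusSiteDist (i.2.1.2 - i.2.2) 0) ^ 2 with hφ
  have hpairset : ∀ u v : GridLeg (GridPoint L Ng), (univ.image ![u, v]).image gridLegPos = {gridLegPos u, gridLegPos v} := by
    intro u v
    rw [image_image]
    ext z
    simp only [mem_image, mem_univ, true_and, Function.comp_apply, Fin.exists_fin_two, Matrix.cons_val_zero, Matrix.cons_val_one,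
      mem_insert, mem_singleton]
    constructor
    · rintro (h | h)
      exacts [Or.inl h.symm, Or.inr h.symm]
    · rintro (h | h)
      exacts [Or.inl h.symm, Or.inr h.symm]
  have hsym : ∀ x y : TorusSite 2 L, torusSiteDist (y - x) 0 = torusSiteDist (x - y) 0 := fun x y => by
    rw [torusSiteDist, torusSiteDist, torusDist, torusDist, sub_zero, sub_zero, ← neg_sub, torusNorm_neg]
  have hω0 : ∀ Y, 0 ≤ ω Y := fun Y => by rw [hω]; dsimp only; rw [diamWeight]; positivity
  have hφa : ∀ i ∈ (univ : Finset (Fin 2 × (GridPoint L Ng × TorusSite 2 L))),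
      ω ![(((i.2.1, i.1), 0) : GridLeg (GridPoint L Ng)), ((((i.2.1.1, i.2.2), i.1), 1) : GridLeg (GridPoint L Ng))] ≤ φ i := by
    intro i _
    rw [hω]; dsimp only
    rw [hpairset, show i.2.1 = (i.2.1.1, i.2.1.2) from rfl, sqWt_pair_sameTime hβ']
  have hφb : ∀ i ∈ (univ : Finset (Fin 2 × (GridPoint L Ng × TorusSite 2 L))),
      ω ![((((i.2.1.1, i.2.2), i.1), 1) : GridLeg (GridPoint L Ng)), (((i.2.1, i.1), 0) : GridLeg (GridPoint L Ng))] ≤ φ i := by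
    intro i _
    rw [hω]; dsimp only
    rw [hpairset, show i.2.1 = (i.2.1.1, i.2.1.2) from rfl, sqWt_pair_sameTime hβ', hsym]
  refine sum_norm_kernel_two_structured_mul_wt_le univ _ _ _ ω hω0 φ hφa hφb (fun w' => ?_) (fun w' => ?_) p w
  · set s := (univ : Finset (Fin 2 × (GridPoint L Ng × TorusSite 2 L))).filter
      (fun i => ((((i.2.1, i.1), 0) : GridLeg (GridPoint L Ng))) = w') with hs
    have hmem : ∀ i ∈ s, i.2.1 = w'.1.1 ∧ i.1 = w'.1.2 := by
      intro i hi
      rw [hs, mem_filter] at hi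
      have h := hi.2
      exact ⟨by rw [← h], by rw [← h]⟩
    have hinj : Set.InjOn (fun i : Fin 2 × (GridPoint L Ng × TorusSite 2 L) => i.2.2) s := by
      intro i hi i' hi' h
      obtain ⟨h1, h2⟩ := hmem i hi
      obtain ⟨h1', h2'⟩ := hmem i' hi'
      exact Prod.ext (h2.trans h2'.symm) (Prod.ext (h1.trans h1'.symm) h)
    set g : TorusSite 2 L → ℝ := fun y => |β| / Ng * (‖framePosKernel L K (w'.1.1.2 - y)‖ * (1 + torusSiteDist (w'.1.1.2 - y) 0) ^ 2) with hg
    have hcongr : ∀ i ∈ s, ‖(((β / Ng : ℝ)) : ℂ) * framePosKernel L K (i.2.1.2 - i.2.2)‖ * φ i = g i.2.2 := by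
      intro i hi
      simp only [hg, hφ]
      rw [(hmem i hi).1, norm_mul, Complex.norm_real, Real.norm_eq_abs, abs_div, Nat.abs_cast]
      ring
    have hg0 : ∀ y, 0 ≤ g y := fun y => by rw [hg]; positivity
    calc ∑ i ∈ s, ‖(((β / Ng : ℝ)) : ℂ) * framePosKernel L K (i.2.1.2 - i.2.2)‖ * φ i = ∑ i ∈ s, g i.2.2 := sum_congr rfl hcongr
      _ = ∑ y ∈ s.image (fun i : Fin 2 × (GridPoint L Ng × TorusSite 2 L) => i.2.2), g y := (sum_image hinj).symm
      _ ≤ ∑ y : TorusSite 2 L, g y := sum_le_sum_of_subset_of_nonneg (subset_univ _) fun y _ _ => hg0 y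
      _ = |β| / Ng * ∑ y : TorusSite 2 L, ‖framePosKernel L K (w'.1.1.2 - y)‖ * (1 + torusSiteDist (w'.1.1.2 - y) 0) ^ 2 := by
          rw [hg, ← mul_sum]
      _ = |β| / Ng * ∑ z : TorusSite 2 L, ‖framePosKernel L K z‖ * (1 + torusSiteDist z 0) ^ 2 := by
          congr 1
          exact Fintype.sum_equiv (Equiv.subLeft w'.1.1.2) _ _ fun y => rfl
  · set s := (univ : Finset (Fin 2 × (GridPoint L Ng × TorusSite 2 L))).filter
      (fun i => (((((i.2.1.1, i.2.2), i.1), 1) : GridLeg (GridPoint L Ng))) = w') with hs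
    have hmem : ∀ i ∈ s, i.2.1.1 = w'.1.1.1 ∧ i.2.2 = w'.1.1.2 ∧ i.1 = w'.1.2 := by
      intro i hi
      rw [hs, mem_filter] at hi
      have h := hi.2
      exact ⟨by rw [← h], by rw [← h], by rw [← h]⟩
    have hinj : Set.InjOn (fun i : Fin 2 × (GridPoint L Ng × TorusSite 2 L) => i.2.1.2) s := by
      intro i hi i' hi' h
      obtain ⟨h1, h2, h3⟩ := hmem i hi
      obtain ⟨h1', h2', h3'⟩ := hmem i' hi'
      exact Prod.ext (h3.trans h3'.symm) (Prod.ext (Prod.ext (h1.trans h1'.symm) h) (h2.trans h2'.symm))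
    set g : TorusSite 2 L → ℝ := fun x => |β| / Ng * (‖framePosKernel L K (x - w'.1.1.2)‖ * (1 + torusSiteDist (x - w'.1.1.2) 0) ^ 2) with hg
    have hcongr : ∀ i ∈ s, ‖(((β / Ng : ℝ)) : ℂ) * framePosKernel L K (i.2.1.2 - i.2.2)‖ * φ i = g i.2.1.2 := by
      intro i hi
      simp only [hg, hφ]
      rw [(hmem i hi).2.1, norm_mul, Complex.norm_real, Real.norm_eq_abs, abs_div, Nat.abs_cast]
      ring
    have hg0 : ∀ x, 0 ≤ g x := fun x => by rw [hg]; positivity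
    calc ∑ i ∈ s, ‖(((β / Ng : ℝ)) : ℂ) * framePosKernel L K (i.2.1.2 - i.2.2)‖ * φ i = ∑ i ∈ s, g i.2.1.2 := sum_congr rfl hcongr
      _ = ∑ x ∈ s.image (fun i : Fin 2 × (GridPoint L Ng × TorusSite 2 L) => i.2.1.2), g x := (sum_image hinj).symm
      _ ≤ ∑ x : TorusSite 2 L, g x := sum_le_sum_of_subset_of_nonneg (subset_univ _) fun x _ _ => hg0 x
      _ = |β| / Ng * ∑ x : TorusSite 2 L, ‖framePosKernel L K (x - w'.1.1.2)‖ * (1 + torusSiteDist (x - w'.1.1.2) 0) ^ 2 := by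
          rw [hg, ← mul_sum]
      _ = |β| / Ng * ∑ z : TorusSite 2 L, ‖framePosKernel L K z‖ * (1 + torusSiteDist z 0) ^ 2 := by
          congr 1
          exact Fintype.sum_equiv (Equiv.subRight w'.1.1.2) _ _ fun x => rfl

/-! ## §3 The squared-weight profile of the grid vertex -/

omit [NeZero Ng] in
/-- The squared-weight profile is nonnegative. -/
theorem scaleZeroPinnedSq_nonneg (β U : ℝ) (K : TrigPolyC4v) (m' : ℕ) :
    0 ≤ (if m' = 1 then |β| / Ng * ∑ z : TorusSite 2 L, ‖framePosKernel L K z‖ * (1 + torusSiteDist z 0) ^ 2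
      else if m' = 2 then |U| * |β| / Ng else 0 : ℝ) := by
  split_ifs
  · positivity
  · positivity
  · exact le_rfl

/-- **The `(1 + diam)²`-weighted pinned profile of the grid vertex** `V_N + 𝒩_{K,N}` — the `N_{w²}` of
`twoLeg_offDiag_moment_two_sum_le`: `N_{w²}(1) = (|β|/N)·Σ_z ‖Ǩ_L(z)‖(1+|z|_{ℓ^∞})²`, `N_{w²}(2) = |U||β|/N`, `0` otherwise. -/
theorem sum_norm_kernel_gridVertex_mul_sqWt_le (β U : ℝ) {β' : ℝ} (hβ' : 0 ≤ β') (K : TrigPolyC4v) (m' : ℕ) (j : Fin (2 * m'))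
    (w : GridLeg (GridPoint L Ng)) :
    ∑ Y ∈ univ.filter (fun Y : Fin (2 * m') → GridLeg (GridPoint L Ng) => Y j = w),
        ‖kernel ℂ (hubbardGridInteraction L Ng β U + hubbardGridCounterQuadratic L Ng β K) (2 * m') Y‖ *
          diamWeight (fun s => (1 + 1 * s) ^ 2) (gridLabelDist L Ng β') ((univ.image Y).image gridLegPos) ≤
      (if m' = 1 then |β| / Ng * ∑ z : TorusSite 2 L, ‖framePosKernel L K z‖ * (1 + torusSiteDist z 0) ^ 2
        else if m' = 2 then |U| * |β| / Ng else 0 : ℝ) := by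
  rcases m' with _ | _ | _ | m'
  · exact absurd j.2 (by omega)
  · have h : ∀ Y : Fin (2 * 1) → GridLeg (GridPoint L Ng),
        kernel ℂ (hubbardGridInteraction L Ng β U + hubbardGridCounterQuadratic L Ng β K) (2 * 1) Y =
          kernel ℂ (hubbardGridCounterQuadratic L Ng β K) 2 Y := fun Y => by
      rw [kernel_add, kernel_hubbardGridInteraction_of_ne β U (by norm_num) Y, zero_add]
    simp only [h, if_true]
    exact sum_norm_kernel_hubbardGridCounterQuadratic_mul_sqWt_le β hβ' K j w
  · have h : ∀ Y : Fin (2 * 2) → GridLeg (GridPoint L Ng),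
        kernel ℂ (hubbardGridInteraction L Ng β U + hubbardGridCounterQuadratic L Ng β K) (2 * 2) Y =
          kernel ℂ (hubbardGridInteraction L Ng β U) 4 Y := fun Y => by
      rw [kernel_add, kernel_hubbardGridCounterQuadratic_of_ne β K (by norm_num) Y, add_zero]
    simp only [h, show (1 + 1 : ℕ) = 2 from rfl, if_true, show (2 : ℕ) ≠ 1 by norm_num, if_false]
    exact sum_norm_kernel_hubbardGridInteraction_mul_sqWt_le β U β' j w
  · refine le_of_eq_of_le (sum_eq_zero fun Y _ => ?_) (scaleZeroPinnedSq_nonneg β U K _)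
    rw [kernel_gridVertex_of_two_lt β U K (m' + 3) (by omega) Y, norm_zero, zero_mul]

end Summit.HubbardSuperconductivity.HubbardSuperconductivity.Theorems.EngineV8

end
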